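import Mathlib.Analysis.SpecialFunctions.Pow.Real
import Mathlib.Analysis.SpecialFunctions.Log.Basic
import Mathlib.Analysis.Complex.Basic
import Mathlib.Algebra.BigOperators.Intervals
import HarnessLib

/-!
# Polymath 15: the elementary summation lemmas of the verification method (Lemmas 8.2, 10.1)

Trunk T-ANT (`Literature/NumberTheory/LFunctions`); companion of
`Polymath15EffectiveApproximation.lean` (the objects `f_t`, `b_n^t = exp((t/4) log² n)`, … of
Polymath 15, Thm. 1.3, and the structure of the Table 1 numerics behind
`Literature.NumberTheory.LFunctions.Polymath15.table1_row2`). Both lemmas below are PROVED; they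
are the analytic (non-computational) ingredients with which Polymath 15 lower-bounds the
Riemann–Siegel type sums `∑_{n ≤ N} b_n^t n^{−s}` when verifying hypothesis (ii) of its Thm. 1.2:

* `sum_bCoeff_div_rpow_le` — **Lemma 8.2** (tail control for large `N`, used in §8.3 for the
  range `N ≥ N₁` and in §10): `∑_{n=1}^N b_n^t/n^σ ≤ ∑_{n=1}^{N₀} b_n^t/n^σ +
  max(N₀^{1−σ} b_{N₀}^t, N^{1−σ} b_N^t) log(N/N₀)`. The printed proof uses that the summands
  decrease (hypothesis `σ > (t/2) log N`) and the integral test, then convexity of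
  `(1 − σ)u + (t/4)u²`; the proof here applies the convexity bound term by term together with
  `1/n ≤ log(n/(n−1))`, which gives the same bound without the monotonicity hypothesis (so the
  theorem is stated for all real `σ` and `t ≥ 0`).
* `euler2_mollifier_bounds` — **Lemma 10.1** (the "Euler 2 mollifier" triangle inequalities used
  to lower-bound `|f_{t₀}(x + iy₀)|` at `N = N₀` for the rows of Table 1).

Here `b_n^t` is written out as `Real.exp (t / 4 * Real.log n ^ 2)` (it is
`Polymath15.bCoeff t n` of the companion file, definitionally), so that this file depends on
Mathlib only.

## References

* D. H. J. Polymath, *Effective approximation of heat flow evolution of the Riemann `ξ` function,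
  and a new upper bound for the de Bruijn–Newman constant*, Res. Math. Sci. 6 (2019), Paper 31
  (arXiv:1904.12438): Lemma 8.2 (§8.3), Lemma 10.1 (§10).
-/

noncomputable section

open Complex

namespace Literature.NumberTheory.LFunctions

namespace Polymath15

/-! ## Lemma 8.2: tail control for `∑ b_n^t / n^σ` -/


/-- A convex parabola on an interval is bounded by its values at the endpoints:
`p u + q u² ≤ max(p u₀ + q u₀², p u₁ + q u₁²)` for `u₀ ≤ u ≤ u₁`, `q ≥ 0`. [folklore] -/
theorem linear_add_sq_le_max {p q u₀ u u₁ : ℝ} (hq : 0 ≤ q) (h₀ : u₀ ≤ u) (h₁ : u ≤ u₁) :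
    p * u + q * u ^ 2 ≤ max (p * u₀ + q * u₀ ^ 2) (p * u₁ + q * u₁ ^ 2) := by
  rcases (h₀.trans h₁).eq_or_lt with heq | hlt
  · have hu : u = u₀ := le_antisymm (heq ▸ h₁) h₀
    subst hu
    exact le_max_left _ _
  · set M := max (p * u₀ + q * u₀ ^ 2) (p * u₁ + q * u₁ ^ 2) with hM
    have hM₀ : p * u₀ + q * u₀ ^ 2 ≤ M := le_max_left _ _
    have hM₁ : p * u₁ + q * u₁ ^ 2 ≤ M := le_max_right _ _
    have hA := mul_le_mul_of_nonneg_left hM₀ (sub_nonneg.2 h₁)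
    have hB := mul_le_mul_of_nonneg_left hM₁ (sub_nonneg.2 h₀)
    have hC : 0 ≤ q * ((u₁ - u₀) * ((u - u₀) * (u₁ - u))) :=
      mul_nonneg hq (mul_nonneg (sub_nonneg.2 (h₀.trans h₁))
        (mul_nonneg (sub_nonneg.2 h₀) (sub_nonneg.2 h₁)))
    have key : (u₁ - u₀) * (p * u + q * u ^ 2) ≤ (u₁ - u₀) * M := by
      have hid : (u₁ - u) * (p * u₀ + q * u₀ ^ 2) + (u - u₀) * (p * u₁ + q * u₁ ^ 2) -
          (u₁ - u₀) * (p * u + q * u ^ 2) = q * ((u₁ - u₀) * ((u - u₀) * (u₁ - u))) := by ring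
      nlinarith [hid, hA, hB, hC]
    exact le_of_mul_le_mul_left key (sub_pos.2 hlt)

/-- The quantity `n^{1−σ} b_n^t = exp((1 − σ) log n + (t/4) log² n)` is, for `t ≥ 0`, a convex
function of `log n`, hence bounded on `N₀ ≤ n ≤ N` by the larger of its values at `N₀` and `N`
(the convexity step in the proof of Polymath 15, Lemma 8.2). [cite: Polymath2019, Lemma 8.2] -/
theorem rpow_mul_bCoeff_le_max {t : ℝ} (ht : 0 ≤ t) (σ : ℝ) {a b c : ℕ} (ha : 1 ≤ a) (hab : a ≤ b)
    (hbc : b ≤ c) :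
    (b : ℝ) ^ (1 - σ) * Real.exp (t / 4 * Real.log b ^ 2) ≤
      max ((a : ℝ) ^ (1 - σ) * Real.exp (t / 4 * Real.log a ^ 2))
        ((c : ℝ) ^ (1 - σ) * Real.exp (t / 4 * Real.log c ^ 2)) := by
  have hφ : ∀ n : ℕ, 1 ≤ n → (n : ℝ) ^ (1 - σ) * Real.exp (t / 4 * Real.log n ^ 2) =
      Real.exp ((1 - σ) * Real.log n + t / 4 * Real.log n ^ 2) := by
    intro n hn
    have hn' : (0 : ℝ) < n := by exact_mod_cast hn
    rw [Real.rpow_def_of_pos hn', ← Real.exp_add]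
    ring_nf
  rw [hφ b (ha.trans hab), hφ a ha, hφ c (ha.trans (hab.trans hbc)), ← Real.exp_monotone.map_max]
  refine Real.exp_monotone (linear_add_sq_le_max (by linarith) ?_ ?_)
  · exact Real.log_le_log (by exact_mod_cast ha) (by exact_mod_cast hab)
  · exact Real.log_le_log (by exact_mod_cast (ha.trans hab)) (by exact_mod_cast hbc)

/-- **Polymath 15, Lemma 8.2.** Let `N ≥ N₀ ≥ 1` be natural numbers and `σ` real, `t ≥ 0`. Then
`∑_{n=1}^N b_n^t / n^σ ≤ ∑_{n=1}^{N₀} b_n^t / n^σ + max(N₀^{1−σ} b_{N₀}^t, N^{1−σ} b_N^t) log(N/N₀)`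
(`b_n^t = exp((t/4) log² n)`).
The source assumes `σ, t > 0` and `σ > (t/2) log N` (so that the summands decrease and the
integral test applies); the present proof bounds each term `b_n^t/n^σ = (n^{1−σ} b_n^t)/n`,
`N₀ < n ≤ N`, by `max(…) · log(n/(n−1))` directly (convexity in `log n`,
`rpow_mul_bCoeff_le_max`, and `1/n ≤ log(n/(n−1))`), which telescopes to the same bound and does
not need those hypotheses. [cite: Polymath2019, Lemma 8.2] -/
theorem sum_bCoeff_div_rpow_le {t : ℝ} (ht : 0 ≤ t) (σ : ℝ) {N₀ N : ℕ} (hN₀ : 1 ≤ N₀)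
    (hN : N₀ ≤ N) :
    ∑ n ∈ Finset.Icc 1 N, Real.exp (t / 4 * Real.log n ^ 2) / (n : ℝ) ^ σ ≤
      ∑ n ∈ Finset.Icc 1 N₀, Real.exp (t / 4 * Real.log n ^ 2) / (n : ℝ) ^ σ +
        max ((N₀ : ℝ) ^ (1 - σ) * Real.exp (t / 4 * Real.log N₀ ^ 2))
            ((N : ℝ) ^ (1 - σ) * Real.exp (t / 4 * Real.log N ^ 2)) * Real.log ((N : ℝ) / N₀) := by
  induction N, hN using Nat.le_induction with
  | base =>
    have h0 : (N₀ : ℝ) ≠ 0 := by exact_mod_cast (show N₀ ≠ 0 by omega)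
    simp [div_self h0]
  | succ N hN ih =>
    have hN₀pos : (0 : ℝ) < N₀ := by exact_mod_cast hN₀
    have hNpos : (0 : ℝ) < N := by exact_mod_cast (show 0 < N by omega)
    have hN1pos : (0 : ℝ) < (N + 1 : ℕ) := by exact_mod_cast Nat.succ_pos N
    set M := max ((N₀ : ℝ) ^ (1 - σ) * Real.exp (t / 4 * Real.log N₀ ^ 2))
      ((N : ℝ) ^ (1 - σ) * Real.exp (t / 4 * Real.log N ^ 2)) with hM
    set M' := max ((N₀ : ℝ) ^ (1 - σ) * Real.exp (t / 4 * Real.log N₀ ^ 2))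
      (((N + 1 : ℕ) : ℝ) ^ (1 - σ) * Real.exp (t / 4 * Real.log (N + 1 : ℕ) ^ 2)) with hM'
    -- the running maximum can only grow (convexity), and is nonnegative
    have hMM' : M ≤ M' :=
      max_le (le_max_left _ _) (rpow_mul_bCoeff_le_max ht σ hN₀ hN (Nat.le_succ N))
    have hM'nonneg : 0 ≤ M' :=
      le_trans (mul_nonneg (Real.rpow_nonneg hN₀pos.le _) (Real.exp_pos _).le) (le_max_left _ _)
    -- the logarithms
    have hL : 0 ≤ Real.log ((N : ℝ) / N₀) :=
      Real.log_nonneg ((one_le_div hN₀pos).2 (by exact_mod_cast hN))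
    have hL' : Real.log (((N + 1 : ℕ) : ℝ) / N₀) =
        Real.log ((N : ℝ) / N₀) + Real.log (((N + 1 : ℕ) : ℝ) / N) := by
      rw [← Real.log_mul (div_pos hNpos hN₀pos).ne' (div_pos hN1pos hNpos).ne']
      congr 1
      field_simp
    have hstep : 1 / ((N + 1 : ℕ) : ℝ) ≤ Real.log (((N + 1 : ℕ) : ℝ) / N) := by
      have := Real.one_sub_inv_le_log_of_pos (div_pos hN1pos hNpos)
      rw [inv_div] at this
      convert this using 1
      field_simp
      push_cast
      ring
    -- the new term
    have hterm : Real.exp (t / 4 * Real.log (N + 1 : ℕ) ^ 2) / (((N + 1 : ℕ) : ℝ)) ^ σ =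
        ((N + 1 : ℕ) : ℝ) ^ (1 - σ) * Real.exp (t / 4 * Real.log (N + 1 : ℕ) ^ 2) *
          (1 / ((N + 1 : ℕ) : ℝ)) := by
      rw [Real.rpow_sub hN1pos, Real.rpow_one]
      field_simp
    have hterm_le : Real.exp (t / 4 * Real.log (N + 1 : ℕ) ^ 2) / (((N + 1 : ℕ) : ℝ)) ^ σ ≤
        M' * Real.log (((N + 1 : ℕ) : ℝ) / N) := by
      rw [hterm]
      exact mul_le_mul (le_max_right _ _) hstep (by positivity) hM'nonneg
    rw [Finset.sum_Icc_succ_top (by omega), hL', mul_add]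
    have := mul_le_mul_of_nonneg_right hMM' hL
    push_cast [Nat.cast_succ] at *
    linarith


/-! ## Lemma 10.1: the Euler-2 mollifier triangle inequalities -/


/-- Reindexing the even integers in `[1, N]` by their halves `n ↦ 2n`, `1 ≤ n ≤ N/2`. [folklore] -/
theorem sum_filter_even_Icc_eq {M : Type*} [AddCommMonoid M] (N : ℕ) (g : ℕ → M) :
    ∑ m ∈ (Finset.Icc 1 N).filter Even, g (m / 2) =
      ∑ n ∈ (Finset.Icc 1 N).filter (fun n ↦ 2 * n ≤ N), g n := by
  refine Finset.sum_nbij' (fun m ↦ m / 2) (fun n ↦ 2 * n) ?_ ?_ ?_ ?_ ?_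
  · intro m hm
    simp only [Finset.mem_filter, Finset.mem_Icc] at hm ⊢
    obtain ⟨⟨h1, h2⟩, ⟨r, hr⟩⟩ := hm
    omega
  · intro n hn
    simp only [Finset.mem_filter, Finset.mem_Icc] at hn ⊢
    exact ⟨⟨by omega, hn.2⟩, even_two_mul n⟩
  · intro m hm
    simp only [Finset.mem_filter, Finset.mem_Icc] at hm
    obtain ⟨-, ⟨r, hr⟩⟩ := hm
    show 2 * (m / 2) = m
    omega
  · intro n hn
    show 2 * n / 2 = n
    omega
  · intro m hm
    rfl

/-- **Polymath 15, Lemma 10.1** (the "Euler 2 mollifier" triangle inequalities). Let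
`α₁, …, α_N` be complex numbers (`N ≥ 1`) and let `β₂` be a number such that whenever `1 ≤ n ≤ N`
is even, `β₂ α_{n/2}` lies on the segment `{θ α_n : 0 ≤ θ ≤ 1}`. Then
`|1 − β₂| |∑_{n=1}^N α_n| ≥ 2|α₁| − (1 − |β₂|) ∑_{n=1}^N |α_n| − 2|β₂| ∑_{N/2 < n ≤ N} |α_n|` and
`|1 − β₂| |∑_{n=1}^N α_n| ≤ (1 − |β₂|) ∑_{n=1}^N |α_n| + 2|β₂| ∑_{N/2 < n ≤ N} |α_n|`.
Proof as printed: `(1 − β₂) ∑ α_n = ∑_{m=1}^{2N} (1_{m ≤ N} α_m − 1_{2∣m} β₂ α_{m/2})` and the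
triangle inequality, the hypothesis giving `|α_m − β₂ α_{m/2}| = |α_m| − |β₂||α_{m/2}|` for even
`m ≤ N`. (Used in §10 to lower-bound `|f_{t₀}(x + iy₀)|` at `N = N₀` for the rows of Table 1.)
[cite: Polymath2019, Lemma 10.1] -/
theorem euler2_mollifier_bounds {N : ℕ} (hN : 1 ≤ N) (a : ℕ → ℂ) (β₂ : ℂ)
    (hseg : ∀ n ∈ Finset.Icc 1 N, Even n → ∃ θ : ℝ, 0 ≤ θ ∧ θ ≤ 1 ∧ β₂ * a (n / 2) = θ * a n) :
    2 * ‖a 1‖ - (1 - ‖β₂‖) * ∑ n ∈ Finset.Icc 1 N, ‖a n‖ -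
          2 * ‖β₂‖ * ∑ n ∈ (Finset.Icc 1 N).filter (fun n ↦ N < 2 * n), ‖a n‖ ≤
        ‖1 - β₂‖ * ‖∑ n ∈ Finset.Icc 1 N, a n‖ ∧
      ‖1 - β₂‖ * ‖∑ n ∈ Finset.Icc 1 N, a n‖ ≤
        (1 - ‖β₂‖) * ∑ n ∈ Finset.Icc 1 N, ‖a n‖ +
          2 * ‖β₂‖ * ∑ n ∈ (Finset.Icc 1 N).filter (fun n ↦ N < 2 * n), ‖a n‖ := by
  classical
  -- notation
  set S := ∑ n ∈ Finset.Icc 1 N, a n with hS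
  set A := ∑ n ∈ Finset.Icc 1 N, ‖a n‖ with hA
  set P := ∑ n ∈ (Finset.Icc 1 N).filter (fun n ↦ N < 2 * n), ‖a n‖ with hP
  set Q := ∑ n ∈ (Finset.Icc 1 N).filter (fun n ↦ 2 * n ≤ N), ‖a n‖ with hQ
  have hAPQ : A = P + Q := by
    rw [hA, hP, hQ, ← Finset.sum_filter_add_sum_filter_not (Finset.Icc 1 N) (fun n ↦ N < 2 * n)]
    congr 1
    exact Finset.sum_congr (Finset.filter_congr fun n _ ↦ by simp [not_lt]) fun _ _ ↦ rfl
  -- the mollified summands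
  set d : ℕ → ℂ := fun n ↦ a n - if Even n then β₂ * a (n / 2) else 0 with hd
  have hkey : (1 - β₂) * S = ∑ n ∈ Finset.Icc 1 N, d n -
      β₂ * ∑ n ∈ (Finset.Icc 1 N).filter (fun n ↦ N < 2 * n), a n := by
    have h1 : ∑ n ∈ Finset.Icc 1 N, d n =
        S - β₂ * ∑ n ∈ (Finset.Icc 1 N).filter (fun n ↦ 2 * n ≤ N), a n := by
      simp only [hd, Finset.sum_sub_distrib, ← hS, Finset.mul_sum]
      rw [← Finset.sum_filter, sum_filter_even_Icc_eq N (fun n ↦ β₂ * a n)]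
    have h2 : β₂ * S = β₂ * ∑ n ∈ (Finset.Icc 1 N).filter (fun n ↦ N < 2 * n), a n +
        β₂ * ∑ n ∈ (Finset.Icc 1 N).filter (fun n ↦ 2 * n ≤ N), a n := by
      rw [← mul_add, hS,
        ← Finset.sum_filter_add_sum_filter_not (Finset.Icc 1 N) (fun n ↦ N < 2 * n)]
      congr 3
      exact Finset.filter_congr fun n _ ↦ by simp [not_lt]
    rw [h1, sub_mul, one_mul, h2]
    ring
  -- norms of the mollified summands
  have hdn : ∀ n ∈ Finset.Icc 1 N, ‖d n‖ = ‖a n‖ - if Even n then ‖β₂‖ * ‖a (n / 2)‖ else 0 := by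
    intro n hn
    by_cases he : Even n
    · obtain ⟨θ, h0, h1, hθ⟩ := hseg n hn he
      simp only [hd, he, if_true, hθ]
      rw [← norm_mul, hθ]
      have : a n - (θ : ℂ) * a n = ((1 - θ : ℝ) : ℂ) * a n := by push_cast; ring
      rw [this, norm_mul, norm_mul, Complex.norm_real, Complex.norm_real, Real.norm_eq_abs,
        Real.norm_eq_abs, abs_of_nonneg (by linarith), abs_of_nonneg h0]
      ring
    · simp [hd, he]
  have hsumd : ∑ n ∈ Finset.Icc 1 N, ‖d n‖ = A - ‖β₂‖ * Q := by
    rw [Finset.sum_congr rfl hdn, Finset.sum_sub_distrib, ← hA, ← Finset.sum_filter, hQ,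
      Finset.mul_sum]
    rw [sum_filter_even_Icc_eq N (fun n ↦ ‖β₂‖ * ‖a n‖)]
  -- the tail `β₂ ∑_{N/2 < n ≤ N} a_n`
  have htail : ‖β₂ * ∑ n ∈ (Finset.Icc 1 N).filter (fun n ↦ N < 2 * n), a n‖ ≤ ‖β₂‖ * P := by
    rw [norm_mul]
    exact mul_le_mul_of_nonneg_left (norm_sum_le _ _) (norm_nonneg _)
  have hnormS : ‖1 - β₂‖ * ‖S‖ = ‖(1 - β₂) * S‖ := (norm_mul _ _).symm
  constructor
  · -- lower bound
    have h1mem : 1 ∈ Finset.Icc 1 N := Finset.mem_Icc.2 ⟨le_rfl, hN⟩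
    have hd1 : d 1 = a 1 := by simp [hd]
    have hsplit := Finset.add_sum_erase (Finset.Icc 1 N) (fun n ↦ d n) h1mem
    have hsplit' := Finset.add_sum_erase (Finset.Icc 1 N) (fun n ↦ ‖d n‖) h1mem
    set R := ∑ n ∈ (Finset.Icc 1 N).erase 1, d n with hR
    have hRle : ‖R‖ ≤ ∑ n ∈ (Finset.Icc 1 N).erase 1, ‖d n‖ := norm_sum_le _ _
    have hlow : ‖d 1‖ - ‖R‖ ≤ ‖∑ n ∈ Finset.Icc 1 N, d n‖ := by
      rw [← hsplit]
      have := norm_sub_le (d 1 + R) R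
      simp only [add_sub_cancel_right] at this
      linarith
    rw [hnormS, hkey]
    have := norm_sub_norm_le (∑ n ∈ Finset.Icc 1 N, d n)
      (β₂ * ∑ n ∈ (Finset.Icc 1 N).filter (fun n ↦ N < 2 * n), a n)
    rw [hd1] at hlow hsplit'
    nlinarith [hsumd, hAPQ, hlow, hRle, htail, this, norm_nonneg β₂, norm_nonneg (a 1)]
  · -- upper bound
    rw [hnormS, hkey]
    refine (norm_sub_le _ _).trans ?_
    have := norm_sum_le (Finset.Icc 1 N) d
    nlinarith [hsumd, hAPQ, htail, this, norm_nonneg β₂]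

end Polymath15

end Literature.NumberTheory.LFunctions

end
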